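import Mathlib
import Literature.MathematicalPhysics.QuantumFieldTheory.PointwiseOSBoostVectors
import HarnessLib

/-!
# The ket vector and the bra–ket Gram entry of the pointwise OS boost calculus

Third stage (`PointwiseOSBoostVectors`): `ket_props` — the vector of two inserted points `a, b` above
the virtual reference `qm`, the connector `N(gap(b, qB))` and the upper block vector, with the norm
factorisation `‖ket‖ ≤ (8 C_B)² · 8 · ‖V_B‖` (two insertions only: this is what makes the exponential
type `2Δ`) and the identification of its real values through the change of reference
`shift_chainCfg_cons`; the geometry of the rotating reference points
`q = y - y₂ e₂ - (h/4) R_{-θ₀} e₀` (`planeRot_refPoint_zero`); and `osPointKernel_bra_ket`: the Gram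
entry of the mirror image of the lower block with the upper cluster is `S_n(R_θ x)` (translation by
`R_θ qm`, the involution `θ₀² = 1`, and a permutation of the points).

## References
* J. Glimm, A. Jaffe, *Quantum Physics* (2nd ed. 1987), §19.5–19.7.
* R. F. Streater, CMP 26 (1972) 109–120.
* K. Osterwalder, R. Schrader, CMP 31 (1973); CMP 42 (1975).
-/

noncomputable section

open Filter ComplexConjugate Complex
open scoped InnerProductSpace Topology
open Literature.Probability.LatticeModels
open Literature.Analysis.OperatorTheory Literature.Analysis.OperatorTheory.KernelVectors
  Literature.Analysis.Complex

namespace Literature.MathematicalPhysics.QuantumFieldTheory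

open ChainItem

local notation "E³" => EuclideanSpace ℝ (Fin 3)
local notation "e₀" => EuclideanSpace.single (0 : Fin 3) (1 : ℝ)
local notation "e₁" => EuclideanSpace.single (1 : Fin 3) (1 : ℝ)
local notation "e₂" => EuclideanSpace.single (2 : Fin 3) (1 : ℝ)

variable {H : Type*} [NormedAddCommGroup H] [InnerProductSpace ℂ H] [CompleteSpace H]

/-- **The ket vector**: two inserted points `y₀, y₁` above the reference `qm`, then the connector
to the reference `qB` of the upper block and the upper block vector `Vb`. Holomorphy, real symmetry,
reproduction of the chain configuration of the full list `y₀ :: y₁ :: block` seen from `qm`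
(`shift_chainCfg_cons`), and the norm factorisation `‖ket‖ ≤ (8 C_B)² · 8 · ‖Vb‖`.
[cite: GlimmJaffe1987, §19.5–19.7] -/
theorem ket_props (δ : HalfSpaceConfig 3 0 → H)
    {N : ℂ × ℂ → (H →L[ℂ] H)} {B : ℝ → (H →L[ℂ] H)} {u CB : ℝ} (hu : 0 < u) (hCB : 1 ≤ CB)
    (hNb : ∀ p : ℂ × ℂ, |p.2.im| < p.1.re → ‖N p‖ ≤ 8)
    (hN' : ∀ (U : Set ℂ), IsOpen U → ∀ (q : ℂ → ℂ × ℂ), DifferentiableOn ℂ q U →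
      (∀ z ∈ U, |(q z).2.im| < (q z).1.re) → DifferentiableOn ℂ (fun z => N (q z)) U)
    (hNσ : ∀ t y : ℝ, 0 < t → ∀ b, N ((t : ℂ), (y : ℂ)) (δ b) = δ (b.shift t y))
    (hNc' : ∀ p : ℂ × ℂ, |p.2.im| < p.1.re → ∀ φ : H,
      conjOp δ (N p φ) = N (conj p.1, conj p.2) (conjOp δ φ))
    (hBb : ∀ w, ‖B w‖ ≤ CB) (hBκ : ∀ (w : ℝ) (b : HalfSpaceConfig 3 0), B w (δ b) = δ (b.spinCons hu w))
    (hBc : ∀ (w : ℝ) (φ : H), conjOp δ (B w φ) = B w (conjOp δ φ))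
    {k : ℕ} (y₀ y₁ : E³) (ysB : Fin (k + 1) → E³) (qm qB : E³) {θ₀ ε R h' : ℝ} (hh' : 0 < h')
    (hR : 0 < R) (huR : 2 * u ≤ Real.exp (-R) * h')
    (hga : ∀ θ : ℝ, |θ - θ₀| < ε → h' ≤ planeRot (d := 2) 0 θ y₀ 0 - planeRot (d := 2) 0 θ qm 0)
    (hgab : ∀ θ : ℝ, |θ - θ₀| < ε → h' ≤ planeRot (d := 2) 0 θ y₁ 0 - planeRot (d := 2) 0 θ y₀ 0)
    (hgb : ∀ θ : ℝ, |θ - θ₀| < ε → h' ≤ planeRot (d := 2) 0 θ qB 0 - planeRot (d := 2) 0 θ y₁ 0)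
    {Vb : ℂ → H} (hVb1 : DifferentiableOn ℂ Vb {ζ : ℂ | |ζ.re - θ₀| < ε ∧ |ζ.im| < R})
    (hVb2 : ∀ ζ : ℂ, |ζ.re - θ₀| < ε → |ζ.im| < R → conjOp δ (Vb (conj ζ)) = Vb ζ)
    (hVb3 : ∀ θ : ℝ, |θ - θ₀| < ε → List.IsChain (fun Q P => res u Q + res u P < P.t θ - Q.t θ)
      (virtOf qB :: List.ofFn fun j => itemOf (ysB j)) ∧
      Vb θ = δ (chainCfg (fun t y b => b.shift t y) (fun w b => b.spinCons hu w) u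
        (List.ofFn fun j => itemOf (ysB j)) (virtOf qB) θ (HalfSpaceConfig.empty 3 0)))
    {W : ℂ → H} (hW : W = fun ζ => chainOp N B u [itemOf y₀, itemOf y₁] (virtOf qm) ζ
      (N (gap u (itemOf y₁) (virtOf qB) ζ) (Vb ζ))) :
    DifferentiableOn ℂ W {ζ : ℂ | |ζ.re - θ₀| < ε ∧ |ζ.im| < R} ∧
    (∀ ζ : ℂ, |ζ.re - θ₀| < ε → |ζ.im| < R → conjOp δ (W (conj ζ)) = W ζ) ∧
    (∀ θ : ℝ, |θ - θ₀| < ε →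
      W θ = δ (chainCfg (fun t y b => b.shift t y) (fun w b => b.spinCons hu w) u
        (itemOf y₀ :: itemOf y₁ :: List.ofFn fun j => itemOf (ysB j)) (virtOf qm) θ (HalfSpaceConfig.empty 3 0))) ∧
    (∀ ζ : ℂ, |ζ.re - θ₀| < ε → |ζ.im| < R → ‖W ζ‖ ≤ (8 * CB) ^ 2 * 8 * ‖Vb ζ‖) := by
  set D : Set ℂ := {ζ : ℂ | |ζ.re - θ₀| < ε ∧ |ζ.im| < R} with hD
  have hu2 : 2 * u < h' := by
    have : Real.exp (-R) < 1 := Real.exp_lt_one_iff.2 (by linarith)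
    nlinarith
  -- cone conditions
  have hch : List.IsChain (fun Q P => ∀ z ∈ D, |(gap u Q P z).2.im| < (gap u Q P z).1.re)
      [virtOf qm, itemOf y₀, itemOf y₁] := by
    refine List.IsChain.cons_cons (fun z hz => ?_) (List.IsChain.cons_cons (fun z hz => ?_) (List.IsChain.singleton _))
    · exact gap_mem_tube hu.le hh' huR (by rw [itemOf_t, virtOf_t]; exact hga z.re hz.1) hz.2
    · exact gap_mem_tube hu.le hh' huR (by rw [itemOf_t, itemOf_t]; exact hgab z.re hz.1) hz.2
  have hcon : ∀ z ∈ D, |(gap u (itemOf y₁) (virtOf qB) z).2.im| < (gap u (itemOf y₁) (virtOf qB) z).1.re :=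
    fun z hz => gap_mem_tube hu.le hh' huR (by rw [itemOf_t, virtOf_t]; exact hgb z.re hz.1) hz.2
  have hchAt : ∀ ζ ∈ D, List.IsChain (fun Q P => |(gap u Q P ζ).2.im| < (gap u Q P ζ).1.re)
      [virtOf qm, itemOf y₀, itemOf y₁] := fun ζ hζ => hch.imp fun Q P h => h ζ hζ
  refine ⟨?_, fun ζ hζ hζ' => ?_, fun θ hθ => ?_, fun ζ hζ hζ' => ?_⟩
  · rw [hW]
    refine (differentiableOn_chainOp hN' (isOpen_rect θ₀ ε R) _ _ hch).clm_apply ?_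
    exact (hN' D (isOpen_rect θ₀ ε R) _ (differentiable_gap u _ _).differentiableOn hcon).clm_apply hVb1
  · rw [hW]
    dsimp only
    rw [conjOp_chainOp_apply δ hNc' hBc _ _ ζ (hchAt ζ ⟨hζ, hζ'⟩)]
    congr 1
    have hp := hcon (conj ζ) ⟨by simpa using hζ, by simpa using hζ'⟩
    rw [hNc' _ hp, gap_conj]
    simp only [Complex.conj_conj, Prod.mk.eta, hVb2 ζ hζ hζ']
  · obtain ⟨hchB, hVbθ⟩ := hVb3 θ hθ
    rw [hW]
    dsimp only
    have hg1 : 0 < planeRot (d := 2) 0 θ qB 0 - planeRot (d := 2) 0 θ y₁ 0 - (u + 0) := by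
      have := hgb θ hθ; linarith
    rw [hVbθ, gap_ofReal, res_itemOf, res_virtOf, itemOf_t, virtOf_t, hNσ _ _ hg1]
    -- change the reference of the upper block from `qB` to `y₁`
    rw [List.ofFn_succ] at hchB ⊢
    obtain ⟨hqP, -⟩ := List.isChain_cons_cons.1 hchB
    have hshift := shift_chainCfg_cons hu θ (itemOf (ysB 0)) (List.ofFn fun i => itemOf (ysB i.succ))
      (virtOf qB) (itemOf y₁) (HalfSpaceConfig.empty 3 0) (by linarith)
      (by rw [res_itemOf, res_virtOf, itemOf_t, virtOf_t]; linarith)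
    rw [res_itemOf, res_virtOf, virtOf_t, itemOf_t, ChainItem.s, ChainItem.s] at hshift
    rw [show u + 0 = u - 0 by ring] 
    erw [hshift]
    -- the two-point chain from `qm`
    have hch2 : List.IsChain (fun Q P => res u Q + res u P < P.t θ - Q.t θ) [virtOf qm, itemOf y₀, itemOf y₁] := by
      refine List.IsChain.cons_cons ?_ (List.IsChain.cons_cons ?_ (List.IsChain.singleton _))
      · rw [res_virtOf, res_itemOf, itemOf_t, virtOf_t]; have := hga θ hθ; linarith
      · rw [res_itemOf, res_itemOf, itemOf_t, itemOf_t]; have := hgab θ hθ; linarith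
    rw [chainOp_apply_gen δ (fun t y b => b.shift t y) (fun w b => b.spinCons hu w) hNσ hBκ _ _ θ hch2]
    rfl
  · rw [hW]
    dsimp only
    calc ‖chainOp N B u [itemOf y₀, itemOf y₁] (virtOf qm) ζ (N (gap u (itemOf y₁) (virtOf qB) ζ) (Vb ζ))‖
        ≤ (8 * CB) ^ 2 * ‖N (gap u (itemOf y₁) (virtOf qB) ζ) (Vb ζ)‖ := by
          have := norm_chainOp_apply_le (by norm_num : (0:ℝ) ≤ 8) hCB hNb hBb _ _ ζ (hchAt ζ ⟨hζ, hζ'⟩)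
            (N (gap u (itemOf y₁) (virtOf qB) ζ) (Vb ζ))
          simpa using this
      _ ≤ (8 * CB) ^ 2 * (8 * ‖Vb ζ‖) := by
          gcongr
          exact (N _).le_of_opNorm_le (hNb _ (hcon ζ ⟨hζ, hζ'⟩)) _
      _ = (8 * CB) ^ 2 * 8 * ‖Vb ζ‖ := by ring

/-! ## Geometry of the reference points -/

/-- On an interval of half-width `≤ 1` the cosine of the offset is at least `1/2`. [folklore] -/
theorem half_le_cos_of_abs_sub_lt {θ θ₀ ε : ℝ} (hε1 : ε ≤ 1) (h : |θ - θ₀| < ε) :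
    1 / 2 ≤ Real.cos (θ - θ₀) := by
  have h2 := Real.one_sub_sq_div_two_le_cos (x := θ - θ₀)
  have h3 : (θ - θ₀) ^ 2 ≤ 1 := by
    have h1 : |θ - θ₀| ≤ 1 := by linarith
    have := abs_nonneg (θ - θ₀)
    nlinarith [sq_abs (θ - θ₀)]
  linarith

/-- The height of the rotating reference point `y - y₂ e₂ - c R_{-θ₀} e₀` at the angle `θ`. [folklore] -/
theorem planeRot_refPoint_zero (y : E³) (θ θ₀ c : ℝ) :
    planeRot (d := 2) 0 θ (y - y 2 • e₂ - c • planeRot (d := 2) 0 (-θ₀) e₀) 0 =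
      planeRot (d := 2) 0 θ y 0 - c * Real.cos (θ - θ₀) := by
  simp [planeRot_apply, Real.cos_sub]

/-- The rotating reference point lies in the rotation plane. [folklore] -/
theorem refPoint_two (y : E³) (θ₀ c : ℝ) : (y - y 2 • e₂ - c • planeRot (d := 2) 0 (-θ₀) e₀) 2 = 0 := by
  simp [planeRot_apply]

/-! ## The bra–ket Gram entry is the correlation function -/

/-- **`K(bra, ket) = S_n(R_θ x)`**: the Gram entry of the mirror image of the lower block
(points `x_{a-1}, …, x_0` relative to `qm`) with the upper cluster (points `x_a, …, x_{n-1}` relative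
to `qm`) is the full correlation function at the rotated configuration (translation by `R_θ qm`
and a permutation of the points). [folklore] -/
theorem osPointKernel_bra_ket (S : CorrFamily 3) (hT : IsTranslationInvariant S) (hP : IsPermutationSymmetric S)
    {n a M : ℕ} (x : Fin n → E³) (haM : a + M = n) (gA : Fin a → E³) (g : Fin M → E³)
    (hgAx : ∀ j, gA j = x ⟨a - 1 - j, by omega⟩) (hgx : ∀ j, g j = x ⟨a + j, by omega⟩)
    (θ : ℝ) (qm : E³) {cA cK : HalfSpaceConfig 3 0}
    (hcA : ∃ hinj hpos, cA = ⟨a, fun j => axisReflection 0 (planeRot (d := 2) 0 θ (gA j - qm)), hinj, hpos⟩)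
    (hcK : ∃ hinj hpos, cK = ⟨M, fun j => planeRot (d := 2) 0 θ (g j - qm), hinj, hpos⟩) :
    osPointKernel S cA cK = S n (fun i => planeRot (d := 2) 0 θ (x i)) := by
  obtain ⟨_, _, rfl⟩ := hcA
  obtain ⟨_, _, rfl⟩ := hcK
  unfold osPointKernel
  dsimp only
  -- the index map
  set e : Fin (a + M) → Fin n := Fin.append (fun j : Fin a => ⟨a - 1 - j, by omega⟩)
    (fun j : Fin M => ⟨a + j, by omega⟩) with he
  have hinj : Function.Injective e := by
    intro i j hij
    revert hij
    refine Fin.addCases (fun i' => ?_) (fun i' => ?_) i <;>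
      refine Fin.addCases (fun j' => ?_) (fun j' => ?_) j <;> intro hij <;>
      simp only [he, Fin.append_left, Fin.append_right, Fin.mk.injEq] at hij
    · congr 1; ext; omega
    · omega
    · omega
    · congr 1; ext; omega
  have hbij : Function.Bijective e := by
    rw [Fintype.bijective_iff_injective_and_card]
    exact ⟨hinj, by simp [haM]⟩
  have h1 : (Fin.append (fun j : Fin a => axisReflection 0 (axisReflection 0
      (planeRot (d := 2) 0 θ (gA j - qm))))
      (fun j : Fin M => planeRot (d := 2) 0 θ (g j - qm))) =
      fun i => ((fun i => planeRot (d := 2) 0 θ (x i)) ∘ Equiv.ofBijective e hbij) i + (-planeRot (d := 2) 0 θ qm) := by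
    funext i
    refine Fin.addCases (fun j => ?_) (fun j => ?_) i
    · simp only [Fin.append_left, axisReflection_axisReflection, map_sub, Function.comp_apply,
        Equiv.ofBijective_apply, he, hgAx]
      abel
    · simp only [Fin.append_right, map_sub, Function.comp_apply, Equiv.ofBijective_apply, he, hgx]
      abel
  rw [h1, hT, hP.comp_equiv]

end Literature.MathematicalPhysics.QuantumFieldTheory
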